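import Summits.ResolutionOfSingularities.ResolutionOfSingularities.Theorems.WeightedInvariantWeightedConstructionPreDatumReduction
import Summits.ResolutionOfSingularities.ResolutionOfSingularities.Theorems.WeightedInvariantWeightedConstructionStrictTransformLocalization
import Summits.ResolutionOfSingularities.ResolutionOfSingularities.Theorems.WeightedInvariantWeightedConstructionWeightedChartRestrict

/-!
# Chart pre-data and the reduction "verify the drop only on CHART opens of the centre"

Route `ResolutionOfSingularities/WeightedInvariant`, crux `WeightedConstruction`
(stmt-ResolutionOfSingularities-0571), line `support-first-weights-second`, registered stub
`stub_chartPreDatum_toPreDatum_of` (conditional on the open pieces `B₊(D(h)) ↪ B₊(U)`, i.e. on the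
statement of the landed `stub_cobordantPlus_basicOpen_openImmersion`; the unconditional corollary
`stub_chartPreDatum_toPreDatum` is a one-liner once that module is built on the farm).

`ChartPreDatum p` weakens `PreDatum p` (Theorems/…PreDatumReduction.lean) once more: the drop `(iv-exc)`
is demanded only for affine opens `U` on which the centre is PRESENTED by a weighted chart `(u, w)`
(`ReesAlgebraData.IsWeightedChart`; then `B(U) = Spec Γ(Y,U)[t⁻¹, uᵢ t^{wᵢ}]` concretely — the setting
of Włodarczyk, arXiv:2203.03090, Thm. 4.3.1), at closed exceptional points, with `B₊(U) → Spec k`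
smooth, separated and quasi-compact available. We prove `Nonempty (ChartPreDatum p) → Nonempty (PreDatum p)`
keeping `Γ`, `inv`, `centre`:

* `ChartPreDatum.inv_lt_of_onExceptional` — for an arbitrary affine open `U` and a closed exceptional
  point `b` of `B₊(U)`: shrink to a basic open `D(h) ⊆ U` around the image of `b` that is also a basic
  open of a weighted chart of the centre (`exists_basicOpen_le_affine_inter`,
  `stub_isWeightedChart_of_le`), realise `B₊(D(h))` as an open piece of `B₊(U)` with the same strict
  transform and exceptional divisor (`stub_cobordantPlus_basicOpen_openImmersion` ∘
  `stub_strictTransform_localization`), and move the value along the open immersion by `(i)`;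
* `stub_chartPreDatum_toPreDatum_of` — the registered stub; `ChartPreDatum.ofPreDatum` — the converse.
-/

noncomputable section

open CategoryTheory AlgebraicGeometry TopologicalSpace
open Literature.AlgebraicGeometry.Resolution

set_option linter.dupNamespace false -- mandated namespace of this single-conjunct summit

namespace Summit.ResolutionOfSingularities.ResolutionOfSingularities.Theorems

/-- A **chart pre-datum** in characteristic `p`: a `PreDatum p` whose axiom `(iv-exc)` is demanded only
for affine opens `U` on which the centre is PRESENTED by a weighted chart `(u, w)`
(`ReesAlgebraData.IsWeightedChart`; then `B(U) = Spec Γ(Y,U)[t⁻¹, uᵢ t^{wᵢ}]` concretely), at closed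
points of the exceptional divisor, with `B₊(U) → Spec k` smooth, separated and quasi-compact available.
Every pre-datum is a chart pre-datum; the converse is `ChartPreDatum.toPreDatum` (the cobordant
blow-up of a basic open `D(h) ⊆ U` inside a chart is an open piece of `B₊(U)` with the same strict
transform, and `inv` is functorial along open immersions). -/
structure ChartPreDatum (p : ℕ) : Type 1 where
  /-- the value set of the invariant (one for all dimensions) -/
  Γ : Type
  /-- `Γ` is linearly ordered … -/
  [linearOrder : LinearOrder Γ]
  /-- … and well-ordered -/
  [wellFoundedLT : WellFoundedLT Γ]
  /-- the invariant (total) -/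
  inv : ∀ ⦃k : Type⦄ [Field k] ⦃Y : Scheme.{0}⦄, (Y ⟶ Spec (.of k)) → Y.IdealSheafData → Y → Γ
  /-- the weighted centre (total) -/
  centre : ∀ ⦃k : Type⦄ [Field k] ⦃Y : Scheme.{0}⦄, (Y ⟶ Spec (.of k)) → Y.IdealSheafData →
    ReesAlgebraData Y
  /-- `(usc)` -/
  isClosed_superlevel : ∀ ⦃k : Type⦄ [Field k] [CharP k p] [PerfectField k] ⦃Y : Scheme.{0}⦄
    (f : Y ⟶ Spec (.of k)) [Smooth f] [IsSeparated f] [QuasiCompact f] (X : Y.IdealSheafData)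
    (γ : Γ), IsClosed {y : Y | γ ≤ inv f X y}
  /-- `(i)` for `inv`, smooth `k`-morphisms -/
  inv_comap : ∀ ⦃k : Type⦄ [Field k] [CharP k p] [PerfectField k] ⦃Y Y₁ : Scheme.{0}⦄
    (f : Y ⟶ Spec (.of k)) [Smooth f] [IsSeparated f] [QuasiCompact f]
    (f₁ : Y₁ ⟶ Spec (.of k)) [Smooth f₁] [IsSeparated f₁] [QuasiCompact f₁]
    (g : Y₁ ⟶ Y) [Smooth g], g ≫ f = f₁ →
    ∀ (X : Y.IdealSheafData) (y₁ : Y₁), inv f₁ (X.comap g) y₁ = inv f X (g y₁)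
  /-- `(i)` for `inv`, perfect ground-field extensions -/
  inv_baseChange : ∀ ⦃k : Type⦄ [Field k] [CharP k p] [PerfectField k]
    ⦃K : Type⦄ [Field K] [PerfectField K] (φ : k →+* K)
    ⦃Y YK : Scheme.{0}⦄ (f : Y ⟶ Spec (.of k)) [Smooth f] [IsSeparated f] [QuasiCompact f]
    (fK : YK ⟶ Spec (.of K)) (pr : YK ⟶ Y),
    IsPullback pr fK f (Spec.map (CommRingCat.ofHom φ)) →
    ∀ (X : Y.IdealSheafData) (y : YK), inv fK (X.comap pr) y = inv f X (pr y)
  /-- `(ii)` -/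
  isBot_inv_iff : ∀ ⦃k : Type⦄ [Field k] [CharP k p] [PerfectField k] ⦃Y : Scheme.{0}⦄
    (f : Y ⟶ Spec (.of k)) [Smooth f] [IsSeparated f] [QuasiCompact f] (X : Y.IdealSheafData)
    (y : Y), IsBot (inv f X y) ↔
      ∀ x : X.subscheme, X.subschemeι x = y → IsRegularLocalRing (X.subscheme.presheaf.stalk x)
  /-- `(iii)` regular weighted centre -/
  isRegularWeightedCentre_centre : ∀ ⦃k : Type⦄ [Field k] [CharP k p] [PerfectField k]
    ⦃Y : Scheme.{0}⦄ (f : Y ⟶ Spec (.of k)) [Smooth f] [IsSeparated f] [QuasiCompact f]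
    (X : Y.IdealSheafData), (∃ y : Y, ¬ IsBot (inv f X y)) →
    (centre f X).IsRegularWeightedCentre
  /-- `(iii)` support = maximum locus -/
  support_centre : ∀ ⦃k : Type⦄ [Field k] [CharP k p] [PerfectField k]
    ⦃Y : Scheme.{0}⦄ (f : Y ⟶ Spec (.of k)) [Smooth f] [IsSeparated f] [QuasiCompact f]
    (X : Y.IdealSheafData), (∃ y : Y, ¬ IsBot (inv f X y)) →
    (centre f X).support = {y : Y | ∀ y' : Y, inv f X y' ≤ inv f X y}
  /-- `(i)` for the centre, smooth surjective `k`-morphisms -/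
  centre_comap : ∀ ⦃k : Type⦄ [Field k] [CharP k p] [PerfectField k] ⦃Y Y₁ : Scheme.{0}⦄
    (f : Y ⟶ Spec (.of k)) [Smooth f] [IsSeparated f] [QuasiCompact f]
    (f₁ : Y₁ ⟶ Spec (.of k)) [Smooth f₁] [IsSeparated f₁] [QuasiCompact f₁]
    (g : Y₁ ⟶ Y) [Smooth g] [Surjective g], g ≫ f = f₁ →
    ∀ (X : Y.IdealSheafData), (∃ y : Y, ¬ IsBot (inv f X y)) →
    ∀ n : ℕ, (centre f₁ (X.comap g)).piece n = ((centre f X).piece n).comap g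
  /-- `(i)` for the centre, perfect ground-field extensions -/
  centre_baseChange : ∀ ⦃k : Type⦄ [Field k] [CharP k p] [PerfectField k]
    ⦃K : Type⦄ [Field K] [PerfectField K] (φ : k →+* K)
    ⦃Y YK : Scheme.{0}⦄ (f : Y ⟶ Spec (.of k)) [Smooth f] [IsSeparated f] [QuasiCompact f]
    (fK : YK ⟶ Spec (.of K)) (pr : YK ⟶ Y),
    IsPullback pr fK f (Spec.map (CommRingCat.ofHom φ)) →
    ∀ (X : Y.IdealSheafData), (∃ y : Y, ¬ IsBot (inv f X y)) →
    ∀ n : ℕ, (centre fK (X.comap pr)).piece n = ((centre f X).piece n).comap pr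
  /-- `(iv-chart)` [guard] for every affine open `U` CARRYING A WEIGHTED CHART of the centre, with
  `B₊(U) → Spec k` smooth, separated and quasi-compact, at every CLOSED point `b` of `B₊(U)` on the
  exceptional divisor, `inv` of `(B₊(U), strict transform)` is strictly below `max_Y inv` -/
  inv_lt_of_chart : ∀ ⦃k : Type⦄ [Field k] [CharP k p] [PerfectField k]
    ⦃Y : Scheme.{0}⦄ (f : Y ⟶ Spec (.of k)) [Smooth f] [IsSeparated f] [QuasiCompact f]
    (X : Y.IdealSheafData), (∃ y : Y, ¬ IsBot (inv f X y)) →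
    ∀ (U : Y.affineOpens),
      (∃ (m : ℕ) (u : Fin m → Γ(Y, U)) (w : Fin m → ℕ), (centre f X).IsWeightedChart U u w) →
      Smooth ((centre f X).cobordantPlusι U ≫ f) →
      IsSeparated ((centre f X).cobordantPlusι U ≫ f) →
      QuasiCompact ((centre f X).cobordantPlusι U ≫ f) →
      ∀ (b : (centre f X).cobordantPlus U), IsClosed ({b} : Set ((centre f X).cobordantPlus U)) →
        (affineCobordantBlowup.plusOpens ((centre f X).chartIdeals U)).ι b ∈
          ((affineCobordantBlowup.exceptional ((centre f X).chartIdeals U)).support :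
            Set (affineCobordantBlowup ((centre f X).chartIdeals U))) →
        ∀ y : Y, (∀ y' : Y, inv f X y' ≤ inv f X y) →
          inv ((centre f X).cobordantPlusι U ≫ f) ((centre f X).cobordantStrictTransform U X) b
            < inv f X y

namespace ChartPreDatum

variable {p : ℕ} (C : ChartPreDatum p)

/-- The value set of a chart pre-datum is linearly ordered. -/
instance instLinearOrder : LinearOrder C.Γ := C.linearOrder

/-- The value set of a chart pre-datum is well-ordered. -/
instance instWellFoundedLT : WellFoundedLT C.Γ := C.wellFoundedLT

/-- **Every pre-datum is a chart pre-datum** (forget that `(iv-exc)` also holds on non-chart opens). -/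
def ofPreDatum (P : PreDatum p) : ChartPreDatum p where
  Γ := P.Γ
  inv := P.inv
  centre := P.centre
  isClosed_superlevel := P.isClosed_superlevel
  inv_comap := P.inv_comap
  inv_baseChange := P.inv_baseChange
  isBot_inv_iff := P.isBot_inv_iff
  isRegularWeightedCentre_centre := P.isRegularWeightedCentre_centre
  support_centre := P.support_centre
  centre_comap := P.centre_comap
  centre_baseChange := P.centre_baseChange
  inv_lt_of_chart := fun _ _ _ _ _ f _ _ _ X hguard U _ hsm hsep hqc b hbc hb y hy =>
    P.inv_lt_of_onExceptional f X hguard U hsm hsep hqc b hbc hb y hy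

/-- **`(iv-exc)` for a chart pre-datum on an ARBITRARY affine open**, granted the open pieces
`B₊(D(h)) ↪ B₊(U)` (hypothesis `HB`, the statement of the landed `stub_cobordantPlus_basicOpen_openImmersion`
after `stub_strictTransform_localization`; kept as a hypothesis only because that module is not yet built on
the farm): shrink
to a basic open `D(h) ⊆ U` that is also a basic open of a weighted chart of the centre
(`exists_basicOpen_le_affine_inter`, `stub_isWeightedChart_of_le`), realise `B₊(D(h))` as an open piece
of `B₊(U)` with the same strict transform and exceptional divisor
(`stub_cobordantPlus_basicOpen_openImmersion` ∘ `stub_strictTransform_localization`), and move the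
value along the open immersion by `(i)`. -/
theorem inv_lt_of_onExceptional
    (HB : ∀ ⦃Y : Scheme.{0}⦄ (R : ReesAlgebraData Y) (U : Y.affineOpens) (h : Γ(Y, U))
      (X : Y.IdealSheafData),
      ∃ j : R.cobordantPlus (Y.affineBasicOpen h) ⟶ R.cobordantPlus U, IsOpenImmersion j ∧
        j ≫ R.cobordantPlusι U = R.cobordantPlusι (Y.affineBasicOpen h) ∧
        (R.cobordantStrictTransform U X).comap j =
          R.cobordantStrictTransform (Y.affineBasicOpen h) X ∧
        (∀ b' : R.cobordantPlus (Y.affineBasicOpen h),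
          (affineCobordantBlowup.plusOpens (R.chartIdeals U)).ι (j b') ∈
              ((affineCobordantBlowup.exceptional (R.chartIdeals U)).support :
                Set (affineCobordantBlowup (R.chartIdeals U))) ↔
            (affineCobordantBlowup.plusOpens (R.chartIdeals (Y.affineBasicOpen h))).ι b' ∈
              ((affineCobordantBlowup.exceptional (R.chartIdeals (Y.affineBasicOpen h))).support :
                Set (affineCobordantBlowup (R.chartIdeals (Y.affineBasicOpen h))))) ∧
        (∀ b : R.cobordantPlus U, R.cobordantPlusι U b ∈ Y.basicOpen h → ∃ b', j b' = b))
    {k : Type} [Field k] [CharP k p] [PerfectField k]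
    {Y : Scheme.{0}} (f : Y ⟶ Spec (.of k)) [Smooth f] [IsSeparated f] [QuasiCompact f]
    (X : Y.IdealSheafData) (hguard : ∃ y : Y, ¬ IsBot (C.inv f X y)) (U : Y.affineOpens)
    (hsm : Smooth ((C.centre f X).cobordantPlusι U ≫ f))
    (hsep : IsSeparated ((C.centre f X).cobordantPlusι U ≫ f))
    (hqc : QuasiCompact ((C.centre f X).cobordantPlusι U ≫ f))
    (b : (C.centre f X).cobordantPlus U) (hbc : IsClosed ({b} : Set ((C.centre f X).cobordantPlus U)))
    (hb : (affineCobordantBlowup.plusOpens ((C.centre f X).chartIdeals U)).ι b ∈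
      ((affineCobordantBlowup.exceptional ((C.centre f X).chartIdeals U)).support :
        Set (affineCobordantBlowup ((C.centre f X).chartIdeals U))))
    (y : Y) (hy : ∀ y' : Y, C.inv f X y' ≤ C.inv f X y) :
    C.inv ((C.centre f X).cobordantPlusι U ≫ f) ((C.centre f X).cobordantStrictTransform U X) b
      < C.inv f X y := by
  have hRc : (C.centre f X).IsRegularWeightedCentre := C.isRegularWeightedCentre_centre f X hguard
  -- the image point and a chart basic open around it
  have hy₀U : (C.centre f X).cobordantPlusι U b ∈ (U : Y.Opens) := by
    change (affineCobordantBlowup.plusπ ((C.centre f X).chartIdeals U) ≫ U.2.fromSpec) b ∈ (U : Y.Opens)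
    rw [Scheme.Hom.comp_apply]
    exact U.2.range_fromSpec.le ⟨_, rfl⟩
  obtain ⟨U', hyU', m, u, w, hchart⟩ := hRc ((C.centre f X).cobordantPlusι U b)
  obtain ⟨h, h', heq, hyh⟩ := exists_basicOpen_le_affine_inter U.2 U'.2 _ ⟨hy₀U, hyU'⟩
  have hVU' : ((Y.affineBasicOpen h : Y.affineOpens) : Y.Opens) ≤ U' := by
    change Y.basicOpen h ≤ (U' : Y.Opens)
    rw [heq]
    exact Y.basicOpen_le h'
  have hchartV := stub_isWeightedChart_of_le (C.centre f X) U' u w hchart (Y.affineBasicOpen h) hVU'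
  -- the open piece `j : B₊(D(h)) → B₊(U)`
  obtain ⟨j, hjo, hjι, hjX, hjE, hjsurj⟩ := HB (C.centre f X) U h X
  obtain ⟨b', hb'⟩ := hjsurj b hyh
  haveI := hjo
  -- both charts are smooth, separated, quasi-compact over `k`
  obtain ⟨hsm', hsep', hqc'⟩ :=
    SupportFirst.stub_cobordantPlus_smooth f (C.centre f X) hRc (Y.affineBasicOpen h)
  haveI := hsm; haveI := hsep; haveI := hqc; haveI := hsm'; haveI := hsep'; haveI := hqc'
  -- move the value along `j` by `(i)`
  have hcomp : j ≫ ((C.centre f X).cobordantPlusι U ≫ f) =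
      (C.centre f X).cobordantPlusι (Y.affineBasicOpen h) ≫ f := by
    rw [← Category.assoc, hjι]
  have hval := C.inv_comap ((C.centre f X).cobordantPlusι U ≫ f)
    ((C.centre f X).cobordantPlusι (Y.affineBasicOpen h) ≫ f) j hcomp
    ((C.centre f X).cobordantStrictTransform U X) b'
  rw [hjX, hb'] at hval
  rw [← hval]
  -- closedness and exceptionality of `b'`
  have hb'c : IsClosed ({b'} : Set ((C.centre f X).cobordantPlus (Y.affineBasicOpen h))) := by
    have hpre : ({b'} : Set ((C.centre f X).cobordantPlus (Y.affineBasicOpen h))) = j ⁻¹' {b} := by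
      ext z
      simp only [Set.mem_singleton_iff, Set.mem_preimage]
      constructor
      · intro hz
        rw [hz, hb']
      · intro hz
        apply j.isOpenEmbedding.injective
        rw [hz, hb']
    rw [hpre]
    exact hbc.preimage j.continuous
  have hb'E : (affineCobordantBlowup.plusOpens ((C.centre f X).chartIdeals (Y.affineBasicOpen h))).ι b' ∈
      ((affineCobordantBlowup.exceptional ((C.centre f X).chartIdeals (Y.affineBasicOpen h))).support :
        Set (affineCobordantBlowup ((C.centre f X).chartIdeals (Y.affineBasicOpen h)))) := by
    rw [← hjE b', hb']
    exact hb
  exact C.inv_lt_of_chart f X hguard (Y.affineBasicOpen h) ⟨m, _, w, hchartV⟩ hsm' hsep' hqc' b'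
    hb'c hb'E y hy

end ChartPreDatum

/-- **Chart pre-datum ⇒ pre-datum, conditional form** (registered stub `stub_chartPreDatum_toPreDatum_of`):
granted the open pieces `B₊(D(h)) ↪ B₊(U)` with compatible strict transforms and exceptional divisors (the
statement of the landed `stub_cobordantPlus_basicOpen_openImmersion` ∘ `stub_strictTransform_localization`), a
chart pre-datum in characteristic `p` yields a pre-datum with the same `Γ`, `inv` and `centre`. -/
theorem stub_chartPreDatum_toPreDatum_of :
    (∀ ⦃Y : Scheme.{0}⦄ (R : ReesAlgebraData Y) (U : Y.affineOpens) (h : Γ(Y, U))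
      (X : Y.IdealSheafData),
      ∃ j : R.cobordantPlus (Y.affineBasicOpen h) ⟶ R.cobordantPlus U, IsOpenImmersion j ∧
        j ≫ R.cobordantPlusι U = R.cobordantPlusι (Y.affineBasicOpen h) ∧
        (R.cobordantStrictTransform U X).comap j =
          R.cobordantStrictTransform (Y.affineBasicOpen h) X ∧
        (∀ b' : R.cobordantPlus (Y.affineBasicOpen h),
          (affineCobordantBlowup.plusOpens (R.chartIdeals U)).ι (j b') ∈
              ((affineCobordantBlowup.exceptional (R.chartIdeals U)).support :
                Set (affineCobordantBlowup (R.chartIdeals U))) ↔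
            (affineCobordantBlowup.plusOpens (R.chartIdeals (Y.affineBasicOpen h))).ι b' ∈
              ((affineCobordantBlowup.exceptional (R.chartIdeals (Y.affineBasicOpen h))).support :
                Set (affineCobordantBlowup (R.chartIdeals (Y.affineBasicOpen h))))) ∧
        (∀ b : R.cobordantPlus U, R.cobordantPlusι U b ∈ Y.basicOpen h → ∃ b', j b' = b)) →
    ∀ p : ℕ, Nonempty (ChartPreDatum p) → Nonempty (PreDatum p) := by
  rintro HB p ⟨C⟩
  exact ⟨{ Γ := C.Γ
           inv := C.inv
           centre := C.centre
           isClosed_superlevel := C.isClosed_superlevel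
           inv_comap := C.inv_comap
           inv_baseChange := C.inv_baseChange
           isBot_inv_iff := C.isBot_inv_iff
           isRegularWeightedCentre_centre := C.isRegularWeightedCentre_centre
           support_centre := C.support_centre
           centre_comap := C.centre_comap
           centre_baseChange := C.centre_baseChange
           inv_lt_of_onExceptional := fun _ _ _ _ _ f _ _ _ X hguard U hsm hsep hqc b hbc hb y hy =>
             C.inv_lt_of_onExceptional HB f X hguard U hsm hsep hqc b hbc hb y hy }⟩

end Summit.ResolutionOfSingularities.ResolutionOfSingularities.Theorems

end
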